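import Mathlib
import HarnessLib
import Summits.Langlands.Statement
import Summits.Langlands.Langlands.Theses.PrimeSwitchSplit
import Summits.Langlands.Langlands.Theses.HodgeTatePurityCarving
import Summits.Langlands.Langlands.Theses.NonParallelVoid
import Summits.Langlands.Langlands.Theses.PrimitiveRankLadder
import Summits.Langlands.Langlands.Theorems.HodgeTatePurityDial

/-!
# `HodgeTatePurityCarving` — CENSUS TWIN, part 2 of 2 (pre-birth Theorems file) of the lens-6 g27 NODE (barrier-complement carving), decomp-langlands, RESIDUAL MODE (writer tenure, INBOX L103)

POST-BIRTH FORM (census-1 g27, 2026-08-31): the route `HodgeTatePurityCarving` was BORN 2026-08-31T08:58:53Z (route-Langlands-HodgeTatePurityCarving rev 0, 90th cell route, first thaw slot); the two cells `PureWeightAutomorphy` (stmt-Langlands-26953) / `ImpureWeightAutomorphy` (stmt-Langlands-26952) and `Assembly` (stmt-Langlands-26954) are therefore USED BY NAME from `Summits.Langlands.Langlands.Theses.HodgeTatePurityCarving` (no restatement; the Assembly is closed separately in `Theorems/HodgeTatePurityCarvingAssembly.lean`, the child seam is the route's own `Theses.HodgeTatePurityCarving.closes`). Parts 1+2 are the node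 `HOME/nodes/lens-6-g27-HodgeTatePurityCarving.lean` with its namespace moved from `…Theses.HodgeTatePurityCarving` to `…Theorems.HodgeTatePurityCarving` and the `#print axioms` guards removed (part 1 = the `section Dial`, `Theorems/HodgeTatePurityDial.lean`); NOTHING is asserted beyond kernel-checked theorems — every `def … : Prop` below is a STATEMENT (the two cells, the test, the leaves, the rungs), consumed only as a hypothesis. It supports stmt-Langlands-17414 (`PrimeSwitchSplit.WeakGeometricAutomorphy`) BY NAME: `weakAut_iff_cells`, `pureb_of_target`, `impb_of_target`, `closes_root`, and the IQ leaf `impureRankTwoIQ_of_void : NonParallelVoid.Target → ImpureRankTwoIQ` via the PROVED `parallelGapPureIQ`. If the route `HodgeTatePurityCarving` is later born, its Theses decls are these texts verbatim (bridges `Iff.rfl`).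

TARGET (used BY NAME, never restated): the rank-2 crux `Summit.Langlands.Langlands.Theses.PrimeSwitchSplit.WeakGeometricAutomorphy`
(stmt-Langlands-17414, the (B)-core `B_w` of N0′ = route `PrimeSwitchSplit`; tree text 868 ch, sha12 7d281a15be13):
every IRREDUCIBLE GEOMETRIC (a.e. unramified, de Rham above `ℓ`) `ρ : Γ_K → GL_n(ℚ̄_ℓ)` is WEAKLY AUTOMORPHIC — some L-algebraic
cuspidal `π` of `GL_n(𝔸_K)` is Satake–Frobenius compatible with `ρ` at almost all places (through `ι : ℚ̄_ℓ ≃ ℂ`).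

THE DIAL `D(K,ℓ,ι,ρ)` = **ι-HODGE–TATE PURITY** (section `Dial`, `IsHodgeTatePure`, the text inserted verbatim after the irreducibility
binder of `B_w`): ONE integer `w` such that for every pair of labels `(v₁,τ₁)`, `(v₂,τ₂)` above `ℓ` (pinned Fontaine data
`fontainePstAdicCompletion`) whose global embeddings are ι-COMPLEX-CONJUGATE PARTNERS (`ι ∘ e₂ = conj ∘ ι ∘ e₁`, `ConjLabel`) the labelled
Hodge–Tate multisets are REFLECTED: `HT_(v₂,τ₂)(ρ) = w − HT_(v₁,τ₁)(ρ)` (`FramedGaloisRep.labelledHodgeTateWeightsAt`, LabelledHodgeTateWeights.lean :655).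
This is the GALOIS-SIDE reading of Clozel's purity lemma / the Hodge symmetry `h^{p,q}_σ = h^{q,p}_{cσ}` of a pure motive
[Clozel1990, Lemme 4.9] [BuzzardGee2014, Conj. 3.2.2 + Rem. 3.2.3: «ρ_π is pure of weight w … HT_{ι⁻¹∘σ̄} = w − HT_σ»]; the summit
`Statement` as typed OMITS the Hodge–Tate recipe of BG Rem. 3.2.3, so purity is NOT a consequence of `Langlands` in the tree — which is
exactly what makes the carving informative: every engine that has ever produced an automorphic `π` from a `ρ` (Taylor–Wiles–Kisin,
Calegari–Geraghty, the 10-author theorem, Boxer–Calegari–Gee–Pilloni, potential automorphy, converse theorems, Serre-weight/eigenvariety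
routes, CM/induction) OUTPUTS an essentially conjugate-self-dual-up-to-twist or at least a regular/irregular algebraic `π`, whose Galois
representation is PURE [ACC⁺ = arXiv:1812.09999, Thm. 6.1.2 + Rem. 6.1.3, p.64: «the weight is conjugate-self-dual up to twist … this
follows from the existence of Π»]; so the IMPURE cell lies OUTSIDE THE CONCLUSION TYPE of every catalogued engine AND of every barrier
(`Literature/Barriers/Langlands/*` bound what automorphy-lifting can reach; none speaks about impure ρ, for which NO REGULAR automorphic
witness over a CM/TR field can exist — HLTT/Scholze/ACC⁺ Hodge–Tate recipe + Clozel purity; in general the emptiness of the automorphic side is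
the Buzzard–Gee recipe Conj. 3.2.2, and the emptiness of the GALOIS side is Fontaine–Mazur + Hodge symmetry).  Lens-6 orientation: A = IMPB (outside every barrier's conclusion class), B = PUREB (structural).

WELL-POSEDNESS (kernel, section `Dial`): `pureb_iff_named`/`impb_iff_named` (definitional: the cells ARE `B_w` guarded by `IsHodgeTatePure` / its
negation, binder for binder); `conjLabel_symm` (the partner relation is symmetric), `conjLabel_iff_comp` (a label has at most one partner EMBEDDING
`ι⁻¹∘conj∘ι∘e₁`, hence at most one partner label by rigidity of pinned labels `PinnedLabel.eq_of_emb_eq`), `IsHodgeTatePure.swap`,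
`map_reflect_reflect`; and — the main certificate — **on a CM field the dial is INTRINSIC**: `isHodgeTatePure_iff_conj` (ι-pure ⟺ one `w`
reflects the weights between every label and its CONJUGATE LABEL `PinnedLabel.conj`, PinnedDatumLabels.lean) and `isHodgeTatePure_iota_indep`
(independent of `ι`).  Over a non-CM `K` the pairing of ℓ-adic labels into «complex-conjugate partners» genuinely depends on `ι` — as it must:
Hodge symmetry is relative to a complex structure — and the cells quantify over ALL `ι`, exactly as `B_w` does.

CELLS (route items; texts = `B_w` verbatim + ONE insertion `D →` / `¬ D →` after the anchor `ρ.toGaloisRep.IsIrreducible → `):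
* `PureWeightAutomorphy`   (PUREB, 1994 ch, sha12 a05ebe5dba76) — tag WEAKER (`pureb_of_target`) · S-implied (`pureb_of_langlands`) ·
  RESIDUAL-OF-RECORD: it is where EVERY existing (B)-node, engine and barrier of the cell tree lives (all their ρ are pure); not attacked here.
* `ImpureWeightAutomorphy` (IMPB, 1996 ch, sha12 e3d4e54991a2) — tag WEAKER (`impb_of_target`) · S-implied (`impb_of_langlands`) ·
  UNDECIDED-with-test `HodgeTatePurity` (HTP, 1775 ch, sha12 27458806e8d9: every irreducible geometric ρ is ι-pure; `impb_of_purity : HTP → IMPB`;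
  HTP is EXCESS — NOT implied by `Langlands` as typed — so it is a TEST, never a residual (rule p1)).  Conjecturally IMPB is the VOID
  sector (object-empty), and its content is the purely GALOIS-THEORETIC statement HTP: no automorphic input can touch it.
EXACTNESS: `weakAut_iff_cells : B_w ↔ (PUREB ∧ IMPB)` (pointwise excluded middle on `D`), the route's own `Theses.HodgeTatePurityCarving.closes`, and `closes_root : PUREB → IMPB →
W⁺ → P → A → R → Langlands` (= `PrimeSwitchSplit.closes` with its proved `AvatarConjugacy_holds`; hypotheses named as in the host route).

LEAVES of IMPB (ledger of record):
* PRINT n = 1: geometric characters come from algebraic Hecke characters, which are pure (Serre, Abelian ℓ-adic representations III;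
  Henniart/Waldschmidt) — `ImpureRankOneRung` (1980 ch) is vacuously true in print; BC5-style rung, plan-only here.
* PRINT (vacuous corner of cell NPO 8401): K imaginary CM, ρ ι-ORDINARY, residually automorphic with enormous image — ACC⁺ Thm. 6.1.2 needs
  NO purity hypothesis and outputs Π, whence purity (Rem. 6.1.3) — so IMPB holds there with EMPTY population.
* **ATTACKED ON THE LEDGER, linked BY NAME (kernel):** K imaginary quadratic, n = 2, REGULAR labels: `ImpureRankTwoIQ` (2547 ch) follows from the
  DORMANT route `NonParallelVoid`'s `Target` ALONE — `impureRankTwoIQ_of_void : NonParallelVoid.Target → ImpureRankTwoIQ` — through the theorem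
  PROVED HERE `parallelGapPureIQ` (2448 ch): over an imaginary quadratic field a rank-2 ρ with regular PARALLEL-GAP labelled weights is
  ι-pure for every ι (the two embeddings `e ≠ ē = ι⁻¹∘conj∘ι∘e` of K into ℚ̄_ℓ exhaust the labels, `emb_dichotomy'`; partners carry conjugate
  embeddings; rigidity), so «impure ∧ regular» = «non-parallel» there, which `NonParallelVoid.Target` says is EMPTY for geometric irreducible ρ
  [Calegari2011 = doi:10.1007/s00222-010-0297-0, Thm. 1.3 (ordinary big-image case proved); CalegariMazur2009].  Halves: `impureNonParallel_of_void`,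
  `impureParallelRankTwoIQ` (PROVED outright), `impureRankTwoIQ_of_halves`.
* OPEN core: non-CM K, or n ≥ 3, or irregular impure ρ — no engine; IDEA-NEEDED = a Galois-side purity theorem for geometric ρ (p-adic Hodge
  theory gives HT symmetry only for ρ coming from motives with a polarisation; for abstract de Rham ρ nothing is known beyond n = 1) or an
  EMPTY-WEIGHT torsion patching argument à la Calegari–Geraghty in impure weights λ, where `H^*(X_K, V_λ)_𝔪 ⊗ ℚ̄_ℓ = 0` for non-Eisenstein 𝔪 (cuspidal part: Borel–Wallach + Clozel purity; boundary: Harder/Franke).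
* INSTRUMENTABLE: Bianchi newforms of NON-PARALLEL weight do not exist in characteristic 0 (Harder) but mod-p classes do (Şengün, Torrey):
  the census cell's data directory; a lift of such a class to a geometric ρ would populate IMPB∣IQ and refute `NonParallelVoid.Target`.

WHY NOVEL (vs the cell tree): no node, census variable (g26 V1–V34) or critic entry uses a GALOIS-SIDE HODGE–TATE PURITY dial; g6
`PurityCarving` = automorphic Satake/Weil–Deligne purity of π (Ramanujan side), lens-1 `ParityLadder` = sign at real places; ledger nearest =
`NonParallelVoid` (n = 2, IQ, stand-alone conjecture) — here it becomes ONE LEAF of an exact partition of `B_w` for all `(K,n,ℓ,ι)`, linked by a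
kernel theorem, and the partition isolates the sector where no regular CM/TR automorphic witness can exist (and none at all under BG 3.2.2).
WHY STRICTLY WEAKER: each cell is `B_w` restricted to a NON-EMPTY-as-typed population (pure ρ exist: all automorphic ones; impure-as-typed ρ
exist formally since the Statement carries no HT recipe — and conjecturally do not, which is the content); `pureb_of_target`, `impb_of_target`;
neither cell gives `B_w` back without the other (pure ρ are untouched by IMPB, impure by PUREB); probes in the kit.

Kernel: Lean 4 + Mathlib, imports = accepted tree modules only; axioms ⊆ {propext, Classical.choice, Quot.sound} (`#print axioms` guards at the
end).  No `sorry`.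
-/

set_option linter.dupNamespace false -- project-wide option (lakefile weak.linter.dupNamespace); `Summit.Langlands.Langlands` is the mandated namespace

namespace Summit.Langlands.Langlands.Theorems.HodgeTatePurityCarving

open scoped BigOperators Topology Manifold Classical MeasureTheory ProbabilityTheory Matrix InnerProductSpace ComplexConjugate ContinuousMap
open Filter Set Function TopologicalSpace MeasureTheory


/-! ## The two cells of the crux (ROUTE ITEMS, by name) and the test (node-local, EXCESS) -/

open Summit.Langlands.Langlands.Theses.HodgeTatePurityCarving (PureWeightAutomorphy ImpureWeightAutomorphy)

/-- test (EXCESS, never a residual; node-local STATEMENT, consumed only as a hypothesis) · HTP · every irreducible geometric ρ is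
ι-Hodge–Tate pure for every ι (the Buzzard–Gee Hodge–Tate recipe read with Clozel's purity lemma — print sources in the module docstring;
NOT implied by `Langlands` as typed, which omits the HT recipe). -/
def HodgeTatePurity : Prop :=
  ∀ (K : Type) [Field K] [NumberField K] (n : ℕ) (hcpt : Literature.NumberTheory.Automorphic.isCompact_glFiniteIntegralLevel n K), 0 < n → ∀ (ℓ : ℕ) [Fact ℓ.Prime] (ι : PadicAlgCl ℓ ≃+* ℂ) (ρ : Literature.NumberTheory.GaloisRepresentations.FramedGaloisRep K (PadicAlgCl ℓ) n), ρ.toGaloisRep.IsIrreducible → ((∀ᶠ v : IsDedekindDomain.HeightOneSpectrum (NumberField.RingOfIntegers K) in cofinite, ρ.IsUnramifiedAt v) ∧ ∀ (v : IsDedekindDomain.HeightOneSpectrum (NumberField.RingOfIntegers K)) (hv : ((ℓ : ℕ) : NumberField.RingOfIntegers K) ∈ v.asIdeal), (Literature.NumberTheory.PAdicHodge.fontainePstAdicCompletion v ℓ hv).IsDeRhamFramed (ρ.toLocal v)) → (∃ w : ℤ, ∀ (v₁ : IsDedekindDomain.HeightOneSpectrum (NumberField.RingOfIntegers K)) (hv₁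 : ((ℓ : ℕ) : NumberField.RingOfIntegers K) ∈ v₁.asIdeal) (v₂ : IsDedekindDomain.HeightOneSpectrum (NumberField.RingOfIntegers K)) (hv₂ : ((ℓ : ℕ) : NumberField.RingOfIntegers K) ∈ v₂.asIdeal), letI := (Literature.NumberTheory.PAdicHodge.fontainePstAdicCompletion v₁ ℓ hv₁).algebra; letI := (Literature.NumberTheory.PAdicHodge.fontainePstAdicCompletion v₂ ℓ hv₂).algebra; ∀ (τ₁ : v₁.adicCompletion K →ₐ[ℚ_[ℓ]] PadicAlgCl ℓ) (τ₂ : v₂.adicCompletion K →ₐ[ℚ_[ℓ]] PadicAlgCl ℓ), (∀ x : K, ι (τ₂ (algebraMap K (v₂.adicCompletion K) x)) = starRingEnd ℂ (ι (τ₁ (algebraMap K (v₁.adicCompletion K) x)))) → ρ.labelledHodgeTateWeightsAt v₂ (Literature.NumberTheory.PAdicHodge.fontainePstAdicCompletion v₂ ℓ hv₂).algebra (Literature.NumberTheory.PAdicHodge.fontainePstAdicCompletion v₂ ℓ hv₂).𝔅 τ₂.toRingHom = Multiset.map (fun k : ℤ => w - k) (ρ.labelledHodgeTateWeightsAt v₁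 (Literature.NumberTheory.PAdicHodge.fontainePstAdicCompletion v₁ ℓ hv₁).algebra (Literature.NumberTheory.PAdicHodge.fontainePstAdicCompletion v₁ ℓ hv₁).𝔅 τ₁.toRingHom))

/-! ## Kernel: EXACT mod NOTHING; closes; both cells WEAKER and S-implied -/

/-- the cells ARE `B_w` guarded by the named dial (definitional identity, binder-for-binder). [folklore] -/
theorem pureb_iff_named : PureWeightAutomorphy ↔
    (∀ (K : Type) [Field K] [NumberField K] (n : ℕ) (hcpt : Literature.NumberTheory.Automorphic.isCompact_glFiniteIntegralLevel n K),
      0 < n → ∀ (ℓ : ℕ) [Fact ℓ.Prime] (ι : PadicAlgCl ℓ ≃+* ℂ)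
      (ρ : Literature.NumberTheory.GaloisRepresentations.FramedGaloisRep K (PadicAlgCl ℓ) n), ρ.toGaloisRep.IsIrreducible →
      IsHodgeTatePure K ℓ ι ρ → ((∀ᶠ v : IsDedekindDomain.HeightOneSpectrum (NumberField.RingOfIntegers K) in cofinite, ρ.IsUnramifiedAt v) ∧ ∀ (v : IsDedekindDomain.HeightOneSpectrum (NumberField.RingOfIntegers K)) (hv : ((ℓ : ℕ) : NumberField.RingOfIntegers K) ∈ v.asIdeal), (Literature.NumberTheory.PAdicHodge.fontainePstAdicCompletion v ℓ hv).IsDeRhamFramed (ρ.toLocal v)) → ∃ π : Literature.NumberTheory.Automorphic.CuspidalAutomorphicRepData n K hcpt, π.1.IsLAlgebraic ∧ ∀ᶠ v : IsDedekindDomain.HeightOneSpectrum (NumberField.RingOfIntegers K) in cofinite, SatakeFrobCompatibleAt ι π.1 ρ v) :=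
  ⟨fun h K _ _ n hcpt hn ℓ _ ι ρ hirr hD hgeo => h K n hcpt hn ℓ ι ρ hirr hD hgeo,
    fun h K _ _ n hcpt hn ℓ _ ι ρ hirr hD hgeo => h K n hcpt hn ℓ ι ρ hirr hD hgeo⟩

/-- idem for the impure cell. [folklore] -/
theorem impb_iff_named : ImpureWeightAutomorphy ↔
    (∀ (K : Type) [Field K] [NumberField K] (n : ℕ) (hcpt : Literature.NumberTheory.Automorphic.isCompact_glFiniteIntegralLevel n K),
      0 < n → ∀ (ℓ : ℕ) [Fact ℓ.Prime] (ι : PadicAlgCl ℓ ≃+* ℂ)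
      (ρ : Literature.NumberTheory.GaloisRepresentations.FramedGaloisRep K (PadicAlgCl ℓ) n), ρ.toGaloisRep.IsIrreducible →
      ¬ IsHodgeTatePure K ℓ ι ρ → ((∀ᶠ v : IsDedekindDomain.HeightOneSpectrum (NumberField.RingOfIntegers K) in cofinite, ρ.IsUnramifiedAt v) ∧ ∀ (v : IsDedekindDomain.HeightOneSpectrum (NumberField.RingOfIntegers K)) (hv : ((ℓ : ℕ) : NumberField.RingOfIntegers K) ∈ v.asIdeal), (Literature.NumberTheory.PAdicHodge.fontainePstAdicCompletion v ℓ hv).IsDeRhamFramed (ρ.toLocal v)) → ∃ π : Literature.NumberTheory.Automorphic.CuspidalAutomorphicRepData n K hcpt, π.1.IsLAlgebraic ∧ ∀ᶠ v : IsDedekindDomain.HeightOneSpectrum (NumberField.RingOfIntegers K) in cofinite, SatakeFrobCompatibleAt ι π.1 ρ v) :=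
  ⟨fun h K _ _ n hcpt hn ℓ _ ι ρ hirr hD hgeo => h K n hcpt hn ℓ ι ρ hirr hD hgeo,
    fun h K _ _ n hcpt hn ℓ _ ι ρ hirr hD hgeo => h K n hcpt hn ℓ ι ρ hirr hD hgeo⟩

/-- **EXACTNESS**: `B_w ↔ (PUREB ∧ IMPB)` — pointwise excluded middle on the dial. [folklore] -/
theorem weakAut_iff_cells : Summit.Langlands.Langlands.Theses.PrimeSwitchSplit.WeakGeometricAutomorphy ↔ (PureWeightAutomorphy ∧ ImpureWeightAutomorphy) := by
  constructor
  · intro h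
    exact ⟨fun K _ _ n hcpt hn ℓ _ ι ρ hirr _ hgeo => h K n hcpt hn ℓ ι ρ hirr hgeo,
      fun K _ _ n hcpt hn ℓ _ ι ρ hirr _ hgeo => h K n hcpt hn ℓ ι ρ hirr hgeo⟩
  · rintro ⟨hP, hI⟩ K _ _ n hcpt hn ℓ _ ι ρ hirr hgeo
    exact Classical.byCases (fun hD => hP K n hcpt hn ℓ ι ρ hirr hD hgeo) (fun hD => hI K n hcpt hn ℓ ι ρ hirr hD hgeo)

/-- PUREB is WEAKER than the target (restriction). [folklore] -/
theorem pureb_of_target (h : Summit.Langlands.Langlands.Theses.PrimeSwitchSplit.WeakGeometricAutomorphy) : PureWeightAutomorphy := (weakAut_iff_cells.1 h).1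

/-- IMPB is WEAKER than the target (restriction). [folklore] -/
theorem impb_of_target (h : Summit.Langlands.Langlands.Theses.PrimeSwitchSplit.WeakGeometricAutomorphy) : ImpureWeightAutomorphy := (weakAut_iff_cells.1 h).2

/-- **closes**: the two cells and the host route's other cruxes (W⁺ = `SatakeAvatarExistence`, P = `PadicMemberCompatibility`,
A = `CompatibilityAwayFromLR`, R = `CanonicalReciprocityData`; `AvatarConjugacy` is PROVED in the host file) give `Langlands`. [folklore] -/
theorem closes_root (hP : PureWeightAutomorphy) (hI : ImpureWeightAutomorphy) (hW : Summit.Langlands.Langlands.Theses.PrimeSwitchSplit.SatakeAvatarExistence)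
    (hPm : Summit.Langlands.Langlands.Theses.PrimeSwitchSplit.PadicMemberCompatibility) (hA : Summit.Langlands.Langlands.Theses.PrimeSwitchSplit.CompatibilityAwayFromLR) (hR : Summit.Langlands.Langlands.Theses.PrimeSwitchSplit.CanonicalReciprocityData) :
    _root_.Langlands :=
  Summit.Langlands.Langlands.Theses.PrimeSwitchSplit.closes (Summit.Langlands.Langlands.Theses.HodgeTatePurityCarving.closes hP hI) hW hPm hA hR Summit.Langlands.Langlands.Theses.PrimeSwitchSplit.AvatarConjugacy_holds

/-- the host crux is implied by the summit — private copy of the landed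
`Theorems.DepthPrimeSplitClassicalityWeight.weak_of_langlands` (that module imports the route file `Theses.DepthPrimeSplit` and had no farm
olean when this node was written; kept private so the tree holds one public statement). [folklore] -/
private theorem target_of_langlands' (hL : _root_.Langlands) : Summit.Langlands.Langlands.Theses.PrimeSwitchSplit.WeakGeometricAutomorphy := by
  intro K _ _ n hcpt hn ℓ _ ι ρ hirr hgeo
  obtain ⟨⟨Rec⟩, h⟩ := hL K
  obtain ⟨π, hπ, hcorr⟩ := (h Rec n hn hcpt).2 ℓ ι ρ hirr ⟨hgeo.1, fun v hv => hgeo.2 v hv⟩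
  exact ⟨π, hπ, hcorr.1⟩

/-- PUREB is S-implied. [folklore] -/
theorem pureb_of_langlands (hL : _root_.Langlands) : PureWeightAutomorphy := pureb_of_target (target_of_langlands' hL)

/-- IMPB is S-implied. [folklore] -/
theorem impb_of_langlands (hL : _root_.Langlands) : ImpureWeightAutomorphy := impb_of_target (target_of_langlands' hL)

/-- the TEST closes the impure cell VACUOUSLY: under `HodgeTatePurity` no irreducible geometric ρ is impure. [folklore] -/
theorem impb_of_purity (h : HodgeTatePurity) : ImpureWeightAutomorphy :=
  fun K _ _ n hcpt hn ℓ _ ι ρ hirr hD hgeo => absurd (h K n hcpt hn ℓ ι ρ hirr hgeo) hD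

/-- hence under the test the whole crux reduces to its pure cell. [folklore] -/
theorem target_of_pureb_of_purity (hP : PureWeightAutomorphy) (h : HodgeTatePurity) : Summit.Langlands.Langlands.Theses.PrimeSwitchSplit.WeakGeometricAutomorphy :=
  Summit.Langlands.Langlands.Theses.HodgeTatePurityCarving.closes hP (impb_of_purity h)

/-! ## The imaginary-quadratic rank-2 leaf of IMPB, linked BY NAME to route `NonParallelVoid` (kernel) -/

/-- leaf · IMPB ∣ (K imaginary quadratic, n = 2, REGULAR labelled weights). (node-local statement; no tag: not a published fact.)  -/
def ImpureRankTwoIQ : Prop :=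
  ∀ (K : Type) [Field K] [NumberField K] [Algebra.IsQuadraticExtension ℚ K], NumberField.IsTotallyComplex K → ∀ (hcpt : Literature.NumberTheory.Automorphic.isCompact_glFiniteIntegralLevel 2 K), ∀ (ℓ : ℕ) [Fact ℓ.Prime] (ι : PadicAlgCl ℓ ≃+* ℂ) (ρ : Literature.NumberTheory.GaloisRepresentations.FramedGaloisRep K (PadicAlgCl ℓ) 2), ρ.toGaloisRep.IsIrreducible → ¬ (∃ w : ℤ, ∀ (v₁ : IsDedekindDomain.HeightOneSpectrum (NumberField.RingOfIntegers K)) (hv₁ : ((ℓ : ℕ) : NumberField.RingOfIntegers K) ∈ v₁.asIdeal) (v₂ : IsDedekindDomain.HeightOneSpectrum (NumberField.RingOfIntegers K)) (hv₂ : ((ℓ : ℕ) : NumberField.RingOfIntegers K) ∈ v₂.asIdeal), letI := (Literature.NumberTheory.PAdicHodge.fontainePstAdicCompletion v₁ ℓ hv₁).algebra; letI := (Literature.NumberTheory.PAdicHodge.fontainePstAdicCompletion v₂ ℓ hv₂).algebra; ∀ (τ₁ : v₁.adicCompletion K →ₐ[ℚ_[ℓ]] PadicAlgCl ℓ) (τ₂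 : v₂.adicCompletion K →ₐ[ℚ_[ℓ]] PadicAlgCl ℓ), (∀ x : K, ι (τ₂ (algebraMap K (v₂.adicCompletion K) x)) = starRingEnd ℂ (ι (τ₁ (algebraMap K (v₁.adicCompletion K) x)))) → ρ.labelledHodgeTateWeightsAt v₂ (Literature.NumberTheory.PAdicHodge.fontainePstAdicCompletion v₂ ℓ hv₂).algebra (Literature.NumberTheory.PAdicHodge.fontainePstAdicCompletion v₂ ℓ hv₂).𝔅 τ₂.toRingHom = Multiset.map (fun k : ℤ => w - k) (ρ.labelledHodgeTateWeightsAt v₁ (Literature.NumberTheory.PAdicHodge.fontainePstAdicCompletion v₁ ℓ hv₁).algebra (Literature.NumberTheory.PAdicHodge.fontainePstAdicCompletion v₁ ℓ hv₁).𝔅 τ₁.toRingHom)) → (∀ (v : IsDedekindDomain.HeightOneSpectrum (NumberField.RingOfIntegers K)) (hv : ((ℓ : ℕ) : NumberField.RingOfIntegers K) ∈ v.asIdeal), letI := (Literature.NumberTheory.PAdicHodge.fontainePstAdicCompletion v ℓ hv).algebra; ∀ τ : v.adicCompletion K →ₐ[ℚ_[ℓ]] PadicAlgCl ℓ, ∃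 a b : ℤ, a < b ∧ ρ.labelledHodgeTateWeightsAt v (Literature.NumberTheory.PAdicHodge.fontainePstAdicCompletion v ℓ hv).algebra (Literature.NumberTheory.PAdicHodge.fontainePstAdicCompletion v ℓ hv).𝔅 τ.toRingHom = {a, b}) → ((∀ᶠ v : IsDedekindDomain.HeightOneSpectrum (NumberField.RingOfIntegers K) in cofinite, ρ.IsUnramifiedAt v) ∧ ∀ (v : IsDedekindDomain.HeightOneSpectrum (NumberField.RingOfIntegers K)) (hv : ((ℓ : ℕ) : NumberField.RingOfIntegers K) ∈ v.asIdeal), (Literature.NumberTheory.PAdicHodge.fontainePstAdicCompletion v ℓ hv).IsDeRhamFramed (ρ.toLocal v)) → ∃ π : Literature.NumberTheory.Automorphic.CuspidalAutomorphicRepData 2 K hcpt, π.1.IsLAlgebraic ∧ ∀ᶠ v : IsDedekindDomain.HeightOneSpectrum (NumberField.RingOfIntegers K) in cofinite, SatakeFrobCompatibleAt ι π.1 ρ v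

/-- half-leaf · … and NON-PARALLEL gaps (this is where `NonParallelVoid.Target` bites). (node-local statement; no tag: not a published fact.)  -/
def ImpureNonParallelRankTwoIQ : Prop :=
  ∀ (K : Type) [Field K] [NumberField K] [Algebra.IsQuadraticExtension ℚ K], NumberField.IsTotallyComplex K → ∀ (hcpt : Literature.NumberTheory.Automorphic.isCompact_glFiniteIntegralLevel 2 K), ∀ (ℓ : ℕ) [Fact ℓ.Prime] (ι : PadicAlgCl ℓ ≃+* ℂ) (ρ : Literature.NumberTheory.GaloisRepresentations.FramedGaloisRep K (PadicAlgCl ℓ) 2), ρ.toGaloisRep.IsIrreducible → ¬ (∃ w : ℤ, ∀ (v₁ : IsDedekindDomain.HeightOneSpectrum (NumberField.RingOfIntegers K)) (hv₁ : ((ℓ : ℕ) : NumberField.RingOfIntegers K) ∈ v₁.asIdeal) (v₂ : IsDedekindDomain.HeightOneSpectrum (NumberField.RingOfIntegers K)) (hv₂ : ((ℓ : ℕ) : NumberField.RingOfIntegers K) ∈ v₂.asIdeal), letI := (Literature.NumberTheory.PAdicHodge.fontainePstAdicCompletion v₁ ℓ hv₁).algebra; letI := (Literature.NumberTheory.PAdicHodge.fontainePstAdicCompletion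 v₂ ℓ hv₂).algebra; ∀ (τ₁ : v₁.adicCompletion K →ₐ[ℚ_[ℓ]] PadicAlgCl ℓ) (τ₂ : v₂.adicCompletion K →ₐ[ℚ_[ℓ]] PadicAlgCl ℓ), (∀ x : K, ι (τ₂ (algebraMap K (v₂.adicCompletion K) x)) = starRingEnd ℂ (ι (τ₁ (algebraMap K (v₁.adicCompletion K) x)))) → ρ.labelledHodgeTateWeightsAt v₂ (Literature.NumberTheory.PAdicHodge.fontainePstAdicCompletion v₂ ℓ hv₂).algebra (Literature.NumberTheory.PAdicHodge.fontainePstAdicCompletion v₂ ℓ hv₂).𝔅 τ₂.toRingHom = Multiset.map (fun k : ℤ => w - k) (ρ.labelledHodgeTateWeightsAt v₁ (Literature.NumberTheory.PAdicHodge.fontainePstAdicCompletion v₁ ℓ hv₁).algebra (Literature.NumberTheory.PAdicHodge.fontainePstAdicCompletion v₁ ℓ hv₁).𝔅 τ₁.toRingHom)) → (∀ (v : IsDedekindDomain.HeightOneSpectrum (NumberField.RingOfIntegers K)) (hv : ((ℓ : ℕ) : NumberField.RingOfIntegers K) ∈ v.asIdeal), letI := (Literature.NumberTheory.PAdicHodge.fontainePstAdicCompletion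 v ℓ hv).algebra; ∀ τ : v.adicCompletion K →ₐ[ℚ_[ℓ]] PadicAlgCl ℓ, ∃ a b : ℤ, a < b ∧ ρ.labelledHodgeTateWeightsAt v (Literature.NumberTheory.PAdicHodge.fontainePstAdicCompletion v ℓ hv).algebra (Literature.NumberTheory.PAdicHodge.fontainePstAdicCompletion v ℓ hv).𝔅 τ.toRingHom = {a, b}) → ¬ (∃ g : ℤ, ∀ (v : IsDedekindDomain.HeightOneSpectrum (NumberField.RingOfIntegers K)) (hv : ((ℓ : ℕ) : NumberField.RingOfIntegers K) ∈ v.asIdeal), letI := (Literature.NumberTheory.PAdicHodge.fontainePstAdicCompletion v ℓ hv).algebra; ∀ τ : v.adicCompletion K →ₐ[ℚ_[ℓ]] PadicAlgCl ℓ, ∃ a : ℤ, ρ.labelledHodgeTateWeightsAt v (Literature.NumberTheory.PAdicHodge.fontainePstAdicCompletion v ℓ hv).algebra (Literature.NumberTheory.PAdicHodge.fontainePstAdicCompletion v ℓ hv).𝔅 τ.toRingHom = {a, a + g}) → ((∀ᶠ v : IsDedekindDomain.HeightOneSpectrum (NumberField.RingOfIntegers K) in cofinite, ρ.IsUnramifiedAt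 v) ∧ ∀ (v : IsDedekindDomain.HeightOneSpectrum (NumberField.RingOfIntegers K)) (hv : ((ℓ : ℕ) : NumberField.RingOfIntegers K) ∈ v.asIdeal), (Literature.NumberTheory.PAdicHodge.fontainePstAdicCompletion v ℓ hv).IsDeRhamFramed (ρ.toLocal v)) → ∃ π : Literature.NumberTheory.Automorphic.CuspidalAutomorphicRepData 2 K hcpt, π.1.IsLAlgebraic ∧ ∀ᶠ v : IsDedekindDomain.HeightOneSpectrum (NumberField.RingOfIntegers K) in cofinite, SatakeFrobCompatibleAt ι π.1 ρ v

/-- half-leaf · … and PARALLEL gaps — PROVED outright below (such ρ are pure: empty population). (node-local statement; no tag: not a published fact.)  -/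
def ImpureParallelRankTwoIQ : Prop :=
  ∀ (K : Type) [Field K] [NumberField K] [Algebra.IsQuadraticExtension ℚ K], NumberField.IsTotallyComplex K → ∀ (hcpt : Literature.NumberTheory.Automorphic.isCompact_glFiniteIntegralLevel 2 K), ∀ (ℓ : ℕ) [Fact ℓ.Prime] (ι : PadicAlgCl ℓ ≃+* ℂ) (ρ : Literature.NumberTheory.GaloisRepresentations.FramedGaloisRep K (PadicAlgCl ℓ) 2), ρ.toGaloisRep.IsIrreducible → ¬ (∃ w : ℤ, ∀ (v₁ : IsDedekindDomain.HeightOneSpectrum (NumberField.RingOfIntegers K)) (hv₁ : ((ℓ : ℕ) : NumberField.RingOfIntegers K) ∈ v₁.asIdeal) (v₂ : IsDedekindDomain.HeightOneSpectrum (NumberField.RingOfIntegers K)) (hv₂ : ((ℓ : ℕ) : NumberField.RingOfIntegers K) ∈ v₂.asIdeal), letI := (Literature.NumberTheory.PAdicHodge.fontainePstAdicCompletion v₁ ℓ hv₁).algebra; letI := (Literature.NumberTheory.PAdicHodge.fontainePstAdicCompletion v₂ ℓ hv₂).algebra; ∀ (τ₁ : v₁.adicCompletion K →ₐ[ℚ_[ℓ]]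 PadicAlgCl ℓ) (τ₂ : v₂.adicCompletion K →ₐ[ℚ_[ℓ]] PadicAlgCl ℓ), (∀ x : K, ι (τ₂ (algebraMap K (v₂.adicCompletion K) x)) = starRingEnd ℂ (ι (τ₁ (algebraMap K (v₁.adicCompletion K) x)))) → ρ.labelledHodgeTateWeightsAt v₂ (Literature.NumberTheory.PAdicHodge.fontainePstAdicCompletion v₂ ℓ hv₂).algebra (Literature.NumberTheory.PAdicHodge.fontainePstAdicCompletion v₂ ℓ hv₂).𝔅 τ₂.toRingHom = Multiset.map (fun k : ℤ => w - k) (ρ.labelledHodgeTateWeightsAt v₁ (Literature.NumberTheory.PAdicHodge.fontainePstAdicCompletion v₁ ℓ hv₁).algebra (Literature.NumberTheory.PAdicHodge.fontainePstAdicCompletion v₁ ℓ hv₁).𝔅 τ₁.toRingHom)) → (∀ (v : IsDedekindDomain.HeightOneSpectrum (NumberField.RingOfIntegers K)) (hv : ((ℓ : ℕ) : NumberField.RingOfIntegers K) ∈ v.asIdeal), letI := (Literature.NumberTheory.PAdicHodge.fontainePstAdicCompletion v ℓ hv).algebra; ∀ τ : v.adicCompletion K →ₐ[ℚ_[ℓ]]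 PadicAlgCl ℓ, ∃ a b : ℤ, a < b ∧ ρ.labelledHodgeTateWeightsAt v (Literature.NumberTheory.PAdicHodge.fontainePstAdicCompletion v ℓ hv).algebra (Literature.NumberTheory.PAdicHodge.fontainePstAdicCompletion v ℓ hv).𝔅 τ.toRingHom = {a, b}) → (∃ g : ℤ, ∀ (v : IsDedekindDomain.HeightOneSpectrum (NumberField.RingOfIntegers K)) (hv : ((ℓ : ℕ) : NumberField.RingOfIntegers K) ∈ v.asIdeal), letI := (Literature.NumberTheory.PAdicHodge.fontainePstAdicCompletion v ℓ hv).algebra; ∀ τ : v.adicCompletion K →ₐ[ℚ_[ℓ]] PadicAlgCl ℓ, ∃ a : ℤ, ρ.labelledHodgeTateWeightsAt v (Literature.NumberTheory.PAdicHodge.fontainePstAdicCompletion v ℓ hv).algebra (Literature.NumberTheory.PAdicHodge.fontainePstAdicCompletion v ℓ hv).𝔅 τ.toRingHom = {a, a + g}) → ((∀ᶠ v : IsDedekindDomain.HeightOneSpectrum (NumberField.RingOfIntegers K) in cofinite, ρ.IsUnramifiedAt v) ∧ ∀ (v : IsDedekindDomain.HeightOneSpectrum (NumberField.RingOfIntegers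 K)) (hv : ((ℓ : ℕ) : NumberField.RingOfIntegers K) ∈ v.asIdeal), (Literature.NumberTheory.PAdicHodge.fontainePstAdicCompletion v ℓ hv).IsDeRhamFramed (ρ.toLocal v)) → ∃ π : Literature.NumberTheory.Automorphic.CuspidalAutomorphicRepData 2 K hcpt, π.1.IsLAlgebraic ∧ ∀ᶠ v : IsDedekindDomain.HeightOneSpectrum (NumberField.RingOfIntegers K) in cofinite, SatakeFrobCompatibleAt ι π.1 ρ v

/-- the statement of `parallelGapPureIQ` as a named Prop (for the kit's probes). (node-local statement; no tag: not a published fact.)  -/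
def ParallelGapPureIQ : Prop :=
  ∀ (K : Type) [Field K] [NumberField K] [Algebra.IsQuadraticExtension ℚ K], NumberField.IsTotallyComplex K → ∀ (hcpt : Literature.NumberTheory.Automorphic.isCompact_glFiniteIntegralLevel 2 K), ∀ (ℓ : ℕ) [Fact ℓ.Prime] (ι : PadicAlgCl ℓ ≃+* ℂ) (ρ : Literature.NumberTheory.GaloisRepresentations.FramedGaloisRep K (PadicAlgCl ℓ) 2), (∀ (v : IsDedekindDomain.HeightOneSpectrum (NumberField.RingOfIntegers K)) (hv : ((ℓ : ℕ) : NumberField.RingOfIntegers K) ∈ v.asIdeal), letI := (Literature.NumberTheory.PAdicHodge.fontainePstAdicCompletion v ℓ hv).algebra; ∀ τ : v.adicCompletion K →ₐ[ℚ_[ℓ]] PadicAlgCl ℓ, ∃ a b : ℤ, a < b ∧ ρ.labelledHodgeTateWeightsAt v (Literature.NumberTheory.PAdicHodge.fontainePstAdicCompletion v ℓ hv).algebra (Literature.NumberTheory.PAdicHodge.fontainePstAdicCompletion v ℓ hv).𝔅 τ.toRingHom = {a, b}) → (∃ g : ℤ, ∀ (v : IsDedekindDomain.HeightOneSpectrum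 (NumberField.RingOfIntegers K)) (hv : ((ℓ : ℕ) : NumberField.RingOfIntegers K) ∈ v.asIdeal), letI := (Literature.NumberTheory.PAdicHodge.fontainePstAdicCompletion v ℓ hv).algebra; ∀ τ : v.adicCompletion K →ₐ[ℚ_[ℓ]] PadicAlgCl ℓ, ∃ a : ℤ, ρ.labelledHodgeTateWeightsAt v (Literature.NumberTheory.PAdicHodge.fontainePstAdicCompletion v ℓ hv).algebra (Literature.NumberTheory.PAdicHodge.fontainePstAdicCompletion v ℓ hv).𝔅 τ.toRingHom = {a, a + g}) → (∃ w : ℤ, ∀ (v₁ : IsDedekindDomain.HeightOneSpectrum (NumberField.RingOfIntegers K)) (hv₁ : ((ℓ : ℕ) : NumberField.RingOfIntegers K) ∈ v₁.asIdeal) (v₂ : IsDedekindDomain.HeightOneSpectrum (NumberField.RingOfIntegers K)) (hv₂ : ((ℓ : ℕ) : NumberField.RingOfIntegers K) ∈ v₂.asIdeal), letI := (Literature.NumberTheory.PAdicHodge.fontainePstAdicCompletion v₁ ℓ hv₁).algebra; letI := (Literature.NumberTheory.PAdicHodge.fontainePstAdicCompletion v₂ ℓ hv₂).algebra; ∀ (τ₁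 : v₁.adicCompletion K →ₐ[ℚ_[ℓ]] PadicAlgCl ℓ) (τ₂ : v₂.adicCompletion K →ₐ[ℚ_[ℓ]] PadicAlgCl ℓ), (∀ x : K, ι (τ₂ (algebraMap K (v₂.adicCompletion K) x)) = starRingEnd ℂ (ι (τ₁ (algebraMap K (v₁.adicCompletion K) x)))) → ρ.labelledHodgeTateWeightsAt v₂ (Literature.NumberTheory.PAdicHodge.fontainePstAdicCompletion v₂ ℓ hv₂).algebra (Literature.NumberTheory.PAdicHodge.fontainePstAdicCompletion v₂ ℓ hv₂).𝔅 τ₂.toRingHom = Multiset.map (fun k : ℤ => w - k) (ρ.labelledHodgeTateWeightsAt v₁ (Literature.NumberTheory.PAdicHodge.fontainePstAdicCompletion v₁ ℓ hv₁).algebra (Literature.NumberTheory.PAdicHodge.fontainePstAdicCompletion v₁ ℓ hv₁).𝔅 τ₁.toRingHom))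

/-- `ParallelGapPureIQ` holds (section `Dial`). [folklore] -/
theorem parallelGapPureIQ_holds : ParallelGapPureIQ := parallelGapPureIQ

/-- IMPB restricts to the IQ rank-2 regular leaf. [folklore] -/
theorem impureRankTwoIQ_of_impb (h : ImpureWeightAutomorphy) : ImpureRankTwoIQ :=
  fun K _ _ _ _hK hcpt ℓ _ ι ρ hirr hD _hreg hgeo => h K 2 hcpt two_pos ℓ ι ρ hirr hD hgeo

/-- **the dormant route's Target closes the non-parallel half** (vacuously: it says such ρ do not exist). [folklore] -/
theorem impureNonParallel_of_void (hV : Summit.Langlands.Langlands.Theses.NonParallelVoid.Target) : ImpureNonParallelRankTwoIQ := by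
  intro K _ _ _ hK hcpt ℓ _ ι ρ hirr hD hreg hnpar hgeo
  exact absurd (hV K hK ℓ ρ hirr hgeo.1 (fun v hv => ⟨hgeo.2 v hv, hreg v hv⟩)) hnpar

/-- **the parallel half is PROVED**: parallel-gap regular ρ over an IQ field are pure, so none is impure. [folklore] -/
theorem impureParallelRankTwoIQ : ImpureParallelRankTwoIQ := by
  intro K _ _ _ hK hcpt ℓ _ ι ρ hirr hD hreg hpar hgeo
  exact absurd (parallelGapPureIQ K hK hcpt ℓ ι ρ hreg hpar) hD

/-- the two halves give the leaf (excluded middle on «parallel gaps»). [folklore] -/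
theorem impureRankTwoIQ_of_halves (h₁ : ImpureNonParallelRankTwoIQ) (h₂ : ImpureParallelRankTwoIQ) : ImpureRankTwoIQ := by
  intro K _ _ _ hK hcpt ℓ _ ι ρ hirr hD hreg hgeo
  by_cases hpar : (∃ g : ℤ, ∀ (v : IsDedekindDomain.HeightOneSpectrum (NumberField.RingOfIntegers K)) (hv : ((ℓ : ℕ) : NumberField.RingOfIntegers K) ∈ v.asIdeal), letI := (Literature.NumberTheory.PAdicHodge.fontainePstAdicCompletion v ℓ hv).algebra; ∀ τ : v.adicCompletion K →ₐ[ℚ_[ℓ]] PadicAlgCl ℓ, ∃ a : ℤ, ρ.labelledHodgeTateWeightsAt v (Literature.NumberTheory.PAdicHodge.fontainePstAdicCompletion v ℓ hv).algebra (Literature.NumberTheory.PAdicHodge.fontainePstAdicCompletion v ℓ hv).𝔅 τ.toRingHom = {a, a + g})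
  · exact h₂ K hK hcpt ℓ ι ρ hirr hD hreg hpar hgeo
  · exact h₁ K hK hcpt ℓ ι ρ hirr hD hreg hpar hgeo

/-- **LEAF CLOSED MODULO ONE EXISTING LEDGER ITEM**: `NonParallelVoid.Target → ImpureRankTwoIQ`. [folklore] -/
theorem impureRankTwoIQ_of_void (hV : Summit.Langlands.Langlands.Theses.NonParallelVoid.Target) : ImpureRankTwoIQ :=
  impureRankTwoIQ_of_halves (impureNonParallel_of_void hV) impureParallelRankTwoIQ

/-! ## BC5-style rungs at n = 1 (texts; PRINT: Serre / Henniart–Waldschmidt — geometric characters are algebraic Hecke characters, pure) -/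

/-- rung · PUREB ∣ n = 1. (node-local statement; no tag: not a published fact.)  -/
def PureRankOneRung : Prop :=
  ∀ (K : Type) [Field K] [NumberField K] (hcpt : Literature.NumberTheory.Automorphic.isCompact_glFiniteIntegralLevel 1 K), ∀ (ℓ : ℕ) [Fact ℓ.Prime] (ι : PadicAlgCl ℓ ≃+* ℂ) (ρ : Literature.NumberTheory.GaloisRepresentations.FramedGaloisRep K (PadicAlgCl ℓ) 1), ρ.toGaloisRep.IsIrreducible → (∃ w : ℤ, ∀ (v₁ : IsDedekindDomain.HeightOneSpectrum (NumberField.RingOfIntegers K)) (hv₁ : ((ℓ : ℕ) : NumberField.RingOfIntegers K) ∈ v₁.asIdeal) (v₂ : IsDedekindDomain.HeightOneSpectrum (NumberField.RingOfIntegers K)) (hv₂ : ((ℓ : ℕ) : NumberField.RingOfIntegers K) ∈ v₂.asIdeal), letI := (Literature.NumberTheory.PAdicHodge.fontainePstAdicCompletion v₁ ℓ hv₁).algebra; letI := (Literature.NumberTheory.PAdicHodge.fontainePstAdicCompletion v₂ ℓ hv₂).algebra; ∀ (τ₁ : v₁.adicCompletion K →ₐ[ℚ_[ℓ]] PadicAlgCl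 ℓ) (τ₂ : v₂.adicCompletion K →ₐ[ℚ_[ℓ]] PadicAlgCl ℓ), (∀ x : K, ι (τ₂ (algebraMap K (v₂.adicCompletion K) x)) = starRingEnd ℂ (ι (τ₁ (algebraMap K (v₁.adicCompletion K) x)))) → ρ.labelledHodgeTateWeightsAt v₂ (Literature.NumberTheory.PAdicHodge.fontainePstAdicCompletion v₂ ℓ hv₂).algebra (Literature.NumberTheory.PAdicHodge.fontainePstAdicCompletion v₂ ℓ hv₂).𝔅 τ₂.toRingHom = Multiset.map (fun k : ℤ => w - k) (ρ.labelledHodgeTateWeightsAt v₁ (Literature.NumberTheory.PAdicHodge.fontainePstAdicCompletion v₁ ℓ hv₁).algebra (Literature.NumberTheory.PAdicHodge.fontainePstAdicCompletion v₁ ℓ hv₁).𝔅 τ₁.toRingHom)) → ((∀ᶠ v : IsDedekindDomain.HeightOneSpectrum (NumberField.RingOfIntegers K) in cofinite, ρ.IsUnramifiedAt v) ∧ ∀ (v : IsDedekindDomain.HeightOneSpectrum (NumberField.RingOfIntegers K)) (hv : ((ℓ : ℕ) : NumberField.RingOfIntegers K) ∈ v.asIdeal), (Literature.NumberTheory.PAdicHodge.fontainePstAdicCompletion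 v ℓ hv).IsDeRhamFramed (ρ.toLocal v)) → ∃ π : Literature.NumberTheory.Automorphic.CuspidalAutomorphicRepData 1 K hcpt, π.1.IsLAlgebraic ∧ ∀ᶠ v : IsDedekindDomain.HeightOneSpectrum (NumberField.RingOfIntegers K) in cofinite, SatakeFrobCompatibleAt ι π.1 ρ v

/-- rung · IMPB ∣ n = 1 (vacuous in print: geometric characters are pure). (node-local statement; no tag: not a published fact.)  -/
def ImpureRankOneRung : Prop :=
  ∀ (K : Type) [Field K] [NumberField K] (hcpt : Literature.NumberTheory.Automorphic.isCompact_glFiniteIntegralLevel 1 K), ∀ (ℓ : ℕ) [Fact ℓ.Prime] (ι : PadicAlgCl ℓ ≃+* ℂ) (ρ : Literature.NumberTheory.GaloisRepresentations.FramedGaloisRep K (PadicAlgCl ℓ) 1), ρ.toGaloisRep.IsIrreducible → ¬ (∃ w : ℤ, ∀ (v₁ : IsDedekindDomain.HeightOneSpectrum (NumberField.RingOfIntegers K)) (hv₁ : ((ℓ : ℕ) : NumberField.RingOfIntegers K) ∈ v₁.asIdeal) (v₂ : IsDedekindDomain.HeightOneSpectrum (NumberField.RingOfIntegers K)) (hv₂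 : ((ℓ : ℕ) : NumberField.RingOfIntegers K) ∈ v₂.asIdeal), letI := (Literature.NumberTheory.PAdicHodge.fontainePstAdicCompletion v₁ ℓ hv₁).algebra; letI := (Literature.NumberTheory.PAdicHodge.fontainePstAdicCompletion v₂ ℓ hv₂).algebra; ∀ (τ₁ : v₁.adicCompletion K →ₐ[ℚ_[ℓ]] PadicAlgCl ℓ) (τ₂ : v₂.adicCompletion K →ₐ[ℚ_[ℓ]] PadicAlgCl ℓ), (∀ x : K, ι (τ₂ (algebraMap K (v₂.adicCompletion K) x)) = starRingEnd ℂ (ι (τ₁ (algebraMap K (v₁.adicCompletion K) x)))) → ρ.labelledHodgeTateWeightsAt v₂ (Literature.NumberTheory.PAdicHodge.fontainePstAdicCompletion v₂ ℓ hv₂).algebra (Literature.NumberTheory.PAdicHodge.fontainePstAdicCompletion v₂ ℓ hv₂).𝔅 τ₂.toRingHom = Multiset.map (fun k : ℤ => w - k) (ρ.labelledHodgeTateWeightsAt v₁ (Literature.NumberTheory.PAdicHodge.fontainePstAdicCompletion v₁ ℓ hv₁).algebra (Literature.NumberTheory.PAdicHodge.fontainePstAdicCompletion v₁ ℓ hv₁).𝔅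 τ₁.toRingHom)) → ((∀ᶠ v : IsDedekindDomain.HeightOneSpectrum (NumberField.RingOfIntegers K) in cofinite, ρ.IsUnramifiedAt v) ∧ ∀ (v : IsDedekindDomain.HeightOneSpectrum (NumberField.RingOfIntegers K)) (hv : ((ℓ : ℕ) : NumberField.RingOfIntegers K) ∈ v.asIdeal), (Literature.NumberTheory.PAdicHodge.fontainePstAdicCompletion v ℓ hv).IsDeRhamFramed (ρ.toLocal v)) → ∃ π : Literature.NumberTheory.Automorphic.CuspidalAutomorphicRepData 1 K hcpt, π.1.IsLAlgebraic ∧ ∀ᶠ v : IsDedekindDomain.HeightOneSpectrum (NumberField.RingOfIntegers K) in cofinite, SatakeFrobCompatibleAt ι π.1 ρ v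

/-- PUREB restricts to its n = 1 rung. [folklore] -/
theorem pureRankOne_of_pureb (h : PureWeightAutomorphy) : PureRankOneRung :=
  fun K _ _ hcpt ℓ _ ι ρ hirr hD hgeo => h K 1 hcpt one_pos ℓ ι ρ hirr hD hgeo

/-- IMPB restricts to its n = 1 rung. [folklore] -/
theorem impureRankOne_of_impb (h : ImpureWeightAutomorphy) : ImpureRankOneRung :=
  fun K _ _ hcpt ℓ _ ι ρ hirr hD hgeo => h K 1 hcpt one_pos ℓ ι ρ hirr hD hgeo

/-- **both n = 1 rungs are closed BY NAME by OR-4's rank-one item** `PrimitiveRankLadder.RankOneAutomorphy`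
(stmt-Langlands-24805 = `B_w ∣ n = 1`, registered `stub_rankOne`; CFT + Weil / algebraic Hecke characters: closed-mod-print). [folklore] -/
theorem pureRankOne_of_rankOne (h : Summit.Langlands.Langlands.Theses.PrimitiveRankLadder.RankOneAutomorphy) : PureRankOneRung :=
  fun K _ _ hcpt ℓ _ ι ρ hirr _hD hgeo => h K hcpt ℓ ι ρ hirr hgeo

/-- idem for the impure rung (which is moreover VACUOUS in print: Patrikis arXiv:1207.6724 Cor. 2.2.3, purity of geometric characters). [folklore] -/
theorem impureRankOne_of_rankOne (h : Summit.Langlands.Langlands.Theses.PrimitiveRankLadder.RankOneAutomorphy) : ImpureRankOneRung :=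
  fun K _ _ hcpt ℓ _ ι ρ hirr _hD hgeo => h K hcpt ℓ ι ρ hirr hgeo

end Summit.Langlands.Langlands.Theorems.HodgeTatePurityCarving
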